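import Summits.QuantumFields.YangMills.Theorems.UnitScaleTiltProp7TorusGreen2PoleBounds
import Summits.QuantumFields.YangMills.Theorems.UnitScaleTiltProp7GreenKernelSiteRows
import Summits.QuantumFields.YangMills.Theorems.UnitScaleTiltProp7TorusGreenSizeDecay
import Summits.QuantumFields.YangMills.Theorems.UnitScaleTiltProp7PinnedSupOfGradient
import HarnessLib

/-!
# Route `UnitScaleTilt`, crux K1 «MinimiserStabilityRegPr» (stmt-QuantumFields-19200), route-R E′ path (α′), (E1-b)-cov (N-cov) FLAT-CONV kernel instances, FILE K1: THE SIX GREEN-KERNEL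
# ROWS IN `Site P 0`∕`EK` LETTERS, in the convolution engine's currency `max 1 (tdist z x)` (✓p673901 `Prop7TorusGreenConvolution.conv_bdd_le`∕`conv_lin_le`, and `conv_inv_le`∕`conv_inv_sq_le`):
# for the torus difference `t := EK hk z − EK hk x` (the free kernels' argument, ✓p662031 `hLf` ∕ ✓p663952 `hGf`) — (K-1) `|G̃₁ t| ≤ c∕(1∨tdist)`, (K-2) `|∇G̃₁ t| ≤ c∕(1∨tdist)²`,
# (K-3) `|∇G̃₂ t| ≤ c`, (K-4) `|∇²G̃₂ t| ≤ c∕(1∨tdist)`, (K-5) `|∇³G̃₂ t| ≤ c∕(1∨tdist)²`, (K-6) `|G̃₂ t − G̃₂ 0| ≤ c·(1 + tdist)` — POLE INCLUDED, `c` absolute (`P.d = 3`)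

Cell `ym3-torus`, D-0154 (3c) twin-width seat `ym-ust-19200-w8` (gen 7); ★routeR-w3 g6 word (12) 22:28:29Z «w8-19200: FLAT-CONV KERNEL INSTANCES — GO … the DISPLAYED `hk` rows DISCHARGED for the
five Green kernels in `Site P 0`∕`EK` letters … incl. the DIAGONAL value `z = x`».  Each row = (a landed dist-weighted decay row, `z ≠ 0`) ⊕ (its all-`z` companion, FILE P ✓∕px7∕px13∕✓p669156)
through two conversions: `tdist² ≤ d·Σz̃²` (px4 ✓p662720 `tdist_sq_le_card_mul_sum_sq`), and `|v| ≤ b ∧ |v|·t ≤ a ⇒ |v| ≤ max a b ∕ max 1 t`; (K-6) by the path sum ✓p670497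
`norm_sub_le_tdist_mul_grad`.  THEOREMS ONLY (0 `def`, 0 `sorry`), `G̃₂` via the displayed definition hypothesis `hG` of record on the finest torus `TorusSite P.d (P.L^k·sitesPerDir k)`;
`--supports stmt-QuantumFields-19200`, count-neutral.  YM₃ on T³ is a ladder rung (R3), not the Clay problem; nothing here claims the stub, the crux, d = 4 or the gap.

WHAT IS PROVED (ns `…Theorems.Prop7TorusGreenKernelRows`; `P : Params` with `hd : P.d = 3`, `k ≤ m+K`, `x z : Site P 0`, `t := EK hk z − EK hk x`, `τ := max 1 (Site.tdist z x : ℝ)`).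
* §1 conversion letters `abs_le_div_max_one`, `abs_le_div_max_one_sq`, `mul_tdist_le_of_mul_sqrt`, `mul_tdist_sq_le_of_mul_sum_sq`.
* §2 ★★ `abs_green_EK_le` (K-1, `c∕τ`), ★★ `abs_green_grad_EK_le` (K-2, `c∕τ²`), ★ `abs_green2_grad_EK_le` (K-3, `c`), ★★ `abs_green2_hessian_EK_le` (K-4, `c∕τ`),
  ★★ `abs_green2_thirdDiff_EK_le` (K-5, `c∕τ²`), ★★ `abs_green2_sub_zero_EK_le` (K-6, `c·(1 + tdist)`).
HONEST SCOPE.  Helper lattice lemmas; the `exact conv_…` applications (routeR-w6's four shapes) are FILE K2 once ✓p673901's 2b (`conv_inv_le`∕`conv_inv_sq_le`) is served.  No Yang–Mills statement is touched.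
References: Lawler–Limic, *Random Walk: A Modern Introduction* (2010) Thm 4.3.1 [LawlerLimic2010]; Bałaban, CMP 95 (1984) (1.17) p.20 [Balaban1984PropagatorsI]; CMP 99 (1985) (1.36) [Balaban1985RegularSpaces].
-/

set_option autoImplicit false

noncomputable section

open scoped BigOperators
open Finset

namespace Summit.QuantumFields.YangMills.Theorems.Prop7TorusGreenKernelRows

open Literature.MathematicalPhysics.QuantumFieldTheory.Balaban1983to89
open LatticeFieldCalculus
open B5Prop11Plancherel (Tor fine unitVec)
open B5Eq117TorusCarriers (Mk EK EK_apply)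
open Literature.Probability.LatticeModels (torusGreen TorusSite latticeMomentum dispersion)
open Literature.MathematicalPhysics.QuantumFieldTheory.BalabanImbrieJaffe1984to88.BIJ85Thm711TorusTransport (EK_shift)
open B3Taylor310LocalRemainder (tdist_comm tdist_self)
open Prop7GreenKernelSiteRows (torusGreen_grad_mul_dist_sq_le_of_eq tdist_sq_le_card_mul_sum_sq green2_hessian_mul_dist_le_of_eq)
open Prop7TorusGreenSizeDecay (torusGreen_mul_dist_le_of_eq)
open Prop7TorusGreen2PoleBounds
open Prop7PinnedSupOfGradient (norm_sub_le_tdist_mul_grad)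

/-! ## §1 Conversion letters -/

/-- **Pole ⊕ decay ⇒ `1 ∨ t` currency**: `|v| ≤ b` and `|v|·t ≤ a` give `|v| ≤ max a b ∕ max 1 t` (`t = 0`: the first; `t ≥ 1`: the second). [folklore] -/
theorem abs_le_div_max_one {v a b : ℝ} {t : ℕ} (h0 : |v| ≤ b) (h1 : |v| * (t : ℝ) ≤ a) :
    |v| ≤ max a b / max 1 (t : ℝ) := by
  rw [le_div_iff₀ (by positivity)]
  rcases Nat.eq_zero_or_pos t with ht | ht
  · subst ht
    simp only [Nat.cast_zero]
    rw [max_eq_left (zero_le_one' ℝ), mul_one]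
    exact h0.trans (le_max_right _ _)
  · have ht1 : (1 : ℝ) ≤ t := by exact_mod_cast ht
    rw [max_eq_right ht1]
    exact h1.trans (le_max_left _ _)

/-- the squared version: `|v| ≤ b` and `|v|·t² ≤ a` give `|v| ≤ max a b ∕ (max 1 t)²`. [folklore] -/
theorem abs_le_div_max_one_sq {v a b : ℝ} {t : ℕ} (h0 : |v| ≤ b) (h2 : |v| * (t : ℝ) ^ 2 ≤ a) :
    |v| ≤ max a b / (max 1 (t : ℝ)) ^ 2 := by
  rw [le_div_iff₀ (by positivity)]
  rcases Nat.eq_zero_or_pos t with ht | ht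
  · subst ht
    simp only [Nat.cast_zero]
    rw [max_eq_left (zero_le_one' ℝ), one_pow, mul_one]
    exact h0.trans (le_max_right _ _)
  · have ht1 : (1 : ℝ) ≤ t := by exact_mod_cast ht
    rw [max_eq_right ht1]
    exact h2.trans (le_max_left _ _)

/-- **`tdist` against the Euclidean torus distance under `EK`** (`P.d = 3`): from ✓ `tdist_sq_le_card_mul_sum_sq` (`tdist² ≤ d·Σz̃²`), a row `|v|·√(Σz̃²) ≤ C` gives `|v|·tdist ≤ √3·C`. [folklore] -/
theorem mul_tdist_le_of_mul_sqrt {P : Params} (hd : P.d = 3) {k : ℕ} (hk : k ≤ P.m + P.K) (z x : Site P 0) {v C : ℝ}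
    (h : |v| * Real.sqrt (∑ ν, ((((EK hk z - EK hk x) ν).valMinAbs : ℤ) : ℝ) ^ 2) ≤ C) :
    |v| * ((Site.tdist z x : ℕ) : ℝ) ≤ Real.sqrt 3 * C := by
  have hsq := tdist_sq_le_card_mul_sum_sq hk z x
  have hd3 : (P.d : ℝ) = 3 := by exact_mod_cast hd
  rw [hd3] at hsq
  have hS0 : 0 ≤ ∑ ν, ((((EK hk z - EK hk x) ν).valMinAbs : ℤ) : ℝ) ^ 2 := Finset.sum_nonneg fun _ _ => sq_nonneg _
  have ht : ((Site.tdist z x : ℕ) : ℝ) ≤ Real.sqrt 3 * Real.sqrt (∑ ν, ((((EK hk z - EK hk x) ν).valMinAbs : ℤ) : ℝ) ^ 2) := by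
    rw [← Real.sqrt_mul (by norm_num), ← Real.sqrt_sq (Nat.cast_nonneg _)]
    exact Real.sqrt_le_sqrt (by exact_mod_cast hsq)
  have hC : 0 ≤ C := le_trans (by positivity) h
  calc |v| * ((Site.tdist z x : ℕ) : ℝ) ≤ |v| * (Real.sqrt 3 * Real.sqrt (∑ ν, ((((EK hk z - EK hk x) ν).valMinAbs : ℤ) : ℝ) ^ 2)) :=
        mul_le_mul_of_nonneg_left ht (abs_nonneg _)
    _ = Real.sqrt 3 * (|v| * Real.sqrt (∑ ν, ((((EK hk z - EK hk x) ν).valMinAbs : ℤ) : ℝ) ^ 2)) := by ring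
    _ ≤ Real.sqrt 3 * C := mul_le_mul_of_nonneg_left h (Real.sqrt_nonneg _)

/-- the squared version: a row `|v|·Σz̃² ≤ C` gives `|v|·tdist² ≤ 3·C` (`P.d = 3`). [folklore] -/
theorem mul_tdist_sq_le_of_mul_sum_sq {P : Params} (hd : P.d = 3) {k : ℕ} (hk : k ≤ P.m + P.K) (z x : Site P 0) {v C : ℝ}
    (h : |v| * (∑ ν, ((((EK hk z - EK hk x) ν).valMinAbs : ℤ) : ℝ) ^ 2) ≤ C) :
    |v| * ((Site.tdist z x : ℕ) : ℝ) ^ 2 ≤ 3 * C := by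
  have hsq := tdist_sq_le_card_mul_sum_sq hk z x
  have hd3 : (P.d : ℝ) = 3 := by exact_mod_cast hd
  rw [hd3] at hsq
  calc |v| * ((Site.tdist z x : ℕ) : ℝ) ^ 2 ≤ |v| * (3 * ∑ ν, ((((EK hk z - EK hk x) ν).valMinAbs : ℤ) : ℝ) ^ 2) :=
        mul_le_mul_of_nonneg_left hsq (abs_nonneg _)
    _ = 3 * (|v| * ∑ ν, ((((EK hk z - EK hk x) ν).valMinAbs : ℤ) : ℝ) ^ 2) := by ring
    _ ≤ 3 * C := by linarith

/-! ## §2 The six kernel rows -/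

/-- ★★ **(K-1) the SIZE of `G̃₁`**: `|G̃₁(EK z − EK x)| ≤ c ∕ (1 ∨ tdist(z,x))` for ALL `z, x` (`c` absolute; `P.d = 3`) — px4's ✓p667495 `torusGreen_mul_dist_le` off the pole (`·√3`) ⊕ ✓p669156
`abs_torusGreen_le` at the pole. The engine's `conv_inv_le` row (`a = 1`). [folklore] -/
theorem abs_green_EK_le : ∃ c : ℝ, 0 ≤ c ∧ ∀ (P : Params) (_ : P.d = 3) (k : ℕ) (hk : k ≤ P.m + P.K) (x z : Site P 0),
    |torusGreen (L := P.L ^ k * P.sitesPerDir k) (EK hk z - EK hk x)| ≤ c / max 1 ((Site.tdist z x : ℕ) : ℝ) := by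
  obtain ⟨C, hC⟩ := torusGreen_mul_dist_le_of_eq
  obtain ⟨C₀, hC₀, h₀⟩ := abs_torusGreen_le_of_eq
  refine ⟨max (Real.sqrt 3 * max C 0) C₀, le_max_of_le_right hC₀, ?_⟩
  intro P hd k hk x z
  haveI : NeZero (P.L ^ k * P.sitesPerDir k) := ⟨mul_ne_zero (pow_ne_zero _ P.L_pos.ne') (P.sitesPerDir_ne_zero k)⟩
  refine abs_le_div_max_one (h₀ hd _ _) ?_
  by_cases hzx : z = x
  · subst hzx
    rw [tdist_self]; simp only [Nat.cast_zero, mul_zero]; positivity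
  · have ht : (EK hk z - EK hk x : TorusSite P.d (P.L ^ k * P.sitesPerDir k)) ≠ 0 := fun h =>
      hzx ((EK hk).injective (sub_eq_zero.1 h))
    have h1 := (hC hd (P.L ^ k * P.sitesPerDir k) (EK hk z - EK hk x) ht).trans (le_max_left C 0)
    exact mul_tdist_le_of_mul_sqrt hd hk z x h1

/-- ★★ **(K-2) the GRADIENT of `G̃₁`**: `|G̃₁(EK z − EK x + eᵢ) − G̃₁(EK z − EK x)| ≤ c ∕ (1 ∨ tdist(z,x))²` for ALL `z, x, i` — ✓p659194 (`·Σz̃²`, `·3`) ⊕ px7's ✓ `abs_torusGreen_grad_le`.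
The engine's `conv_inv_sq_le` row (`a = 2`); `EK z − EK x + eᵢ = EK (z.shift i) − EK x` (✓ `EK_shift`) for the consumer's bond reading. [folklore] -/
theorem abs_green_grad_EK_le : ∃ c : ℝ, 0 ≤ c ∧ ∀ (P : Params) (_ : P.d = 3) (k : ℕ) (hk : k ≤ P.m + P.K) (x z : Site P 0) (i : Fin P.d),
    |torusGreen (L := P.L ^ k * P.sitesPerDir k) ((EK hk z - EK hk x) + Pi.single i 1)
        - torusGreen (L := P.L ^ k * P.sitesPerDir k) (EK hk z - EK hk x)| ≤ c / (max 1 ((Site.tdist z x : ℕ) : ℝ)) ^ 2 := by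
  obtain ⟨C, hC⟩ := torusGreen_grad_mul_dist_sq_le_of_eq
  obtain ⟨C₁, hC₁, h₁⟩ := abs_torusGreen_grad_le_of_eq
  refine ⟨max (3 * max C 0) C₁, le_max_of_le_right hC₁, ?_⟩
  intro P hd k hk x z i
  haveI : NeZero (P.L ^ k * P.sitesPerDir k) := ⟨mul_ne_zero (pow_ne_zero _ P.L_pos.ne') (P.sitesPerDir_ne_zero k)⟩
  refine abs_le_div_max_one_sq (h₁ hd _ i _) ?_
  by_cases hzx : z = x
  · subst hzx
    rw [tdist_self]; simp only [Nat.cast_zero]; rw [zero_pow two_ne_zero, mul_zero]; positivity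
  · have ht : (EK hk z - EK hk x : TorusSite P.d (P.L ^ k * P.sitesPerDir k)) ≠ 0 := fun h =>
      hzx ((EK hk).injective (sub_eq_zero.1 h))
    have h1 := (hC hd (P.L ^ k * P.sitesPerDir k) i (EK hk z - EK hk x) ht).trans (le_max_left C 0)
    exact mul_tdist_sq_le_of_mul_sum_sq hd hk z x h1

/-- ★ **(K-3) the GRADIENT of `G̃₂` is bounded**: `|G̃₂(EK z − EK x + eᵢ) − G̃₂(EK z − EK x)| ≤ c` for ALL `z, x, i` (px13's ✓p663183, `d`-wrapped). The engine's `conv_bdd_le` row (`a = 0`). [folklore] -/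
theorem abs_green2_grad_EK_le : ∃ c : ℝ, 0 ≤ c ∧ ∀ (P : Params) (_ : P.d = 3) (k : ℕ) (hk : k ≤ P.m + P.K)
    (G : TorusSite P.d (P.L ^ k * P.sitesPerDir k) → ℝ),
    (∀ t : TorusSite P.d (P.L ^ k * P.sitesPerDir k),
      G t = (∑ q ∈ (univ : Finset (TorusSite P.d (P.L ^ k * P.sitesPerDir k))).erase 0,
        Real.cos (∑ i, latticeMomentum (P.L ^ k * P.sitesPerDir k) q i * ((t i).val : ℝ))
          / dispersion (latticeMomentum (P.L ^ k * P.sitesPerDir k) q) ^ 2)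
        / (((P.L ^ k * P.sitesPerDir k : ℕ) : ℝ)) ^ P.d) →
    ∀ (x z : Site P 0) (i : Fin P.d),
      |G ((EK hk z - EK hk x) + Pi.single i 1) - G (EK hk z - EK hk x)| ≤ c := by
  obtain ⟨C, hC, h⟩ := abs_green2_grad_le_of_eq
  refine ⟨C, hC, ?_⟩
  intro P hd k hk G hG x z i
  haveI : NeZero (P.L ^ k * P.sitesPerDir k) := ⟨mul_ne_zero (pow_ne_zero _ P.L_pos.ne') (P.sitesPerDir_ne_zero k)⟩
  exact h hd _ G hG i _

/-- ★★ **(K-4) the HESSIAN of `G̃₂`**: `|∇ᵢ⁺∇ⱼ⁻G̃₂(EK z − EK x)| ≤ c ∕ (1 ∨ tdist(z,x))` for ALL `z, x, i, j` — (R3a) ✓p662426 (`·√Σz̃²`, `·√3`) ⊕ FILE P §1 at the pole. The engine's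
`conv_inv_le` row (`a = 1`). [folklore] -/
theorem abs_green2_hessian_EK_le : ∃ c : ℝ, 0 ≤ c ∧ ∀ (P : Params) (_ : P.d = 3) (k : ℕ) (hk : k ≤ P.m + P.K)
    (G : TorusSite P.d (P.L ^ k * P.sitesPerDir k) → ℝ),
    (∀ t : TorusSite P.d (P.L ^ k * P.sitesPerDir k),
      G t = (∑ q ∈ (univ : Finset (TorusSite P.d (P.L ^ k * P.sitesPerDir k))).erase 0,
        Real.cos (∑ i, latticeMomentum (P.L ^ k * P.sitesPerDir k) q i * ((t i).val : ℝ))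
          / dispersion (latticeMomentum (P.L ^ k * P.sitesPerDir k) q) ^ 2)
        / (((P.L ^ k * P.sitesPerDir k : ℕ) : ℝ)) ^ P.d) →
    ∀ (x z : Site P 0) (i j : Fin P.d),
      |G ((EK hk z - EK hk x) + Pi.single i 1) - G ((EK hk z - EK hk x) + Pi.single i 1 - Pi.single j 1)
          - G (EK hk z - EK hk x) + G ((EK hk z - EK hk x) - Pi.single j 1)| ≤ c / max 1 ((Site.tdist z x : ℕ) : ℝ) := by
  obtain ⟨C, hC⟩ := green2_hessian_mul_dist_le_of_eq
  obtain ⟨C₀, hC₀, h₀⟩ := abs_green2_hessian_le_of_eq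
  refine ⟨max (Real.sqrt 3 * max C 0) C₀, le_max_of_le_right hC₀, ?_⟩
  intro P hd k hk G hG x z i j
  haveI : NeZero (P.L ^ k * P.sitesPerDir k) := ⟨mul_ne_zero (pow_ne_zero _ P.L_pos.ne') (P.sitesPerDir_ne_zero k)⟩
  refine abs_le_div_max_one (h₀ hd _ G hG i j _) ?_
  by_cases hzx : z = x
  · subst hzx
    rw [tdist_self]; simp only [Nat.cast_zero, mul_zero]; positivity
  · have ht : (EK hk z - EK hk x : TorusSite P.d (P.L ^ k * P.sitesPerDir k)) ≠ 0 := fun h =>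
      hzx ((EK hk).injective (sub_eq_zero.1 h))
    have h1 := (hC hd (P.L ^ k * P.sitesPerDir k) G hG i j (EK hk z - EK hk x) ht).trans (le_max_left C 0)
    exact mul_tdist_le_of_mul_sqrt hd hk z x h1

/-- ★★ **(K-5) the THIRD DIFFERENCES of `G̃₂`**: `|∇ᵢ⁺∇ⱼ⁻G̃₂(t) − ∇ᵢ⁺∇ⱼ⁻G̃₂(t − e_k)| ≤ c ∕ (1 ∨ tdist(z,x))²`, `t = EK z − EK x`, for ALL `z, x` and every pattern `(i,j,k)` —
(R3b) ✓p662832 (`·Σz̃²`, `·3`) ⊕ FILE P §2 at the pole. The engine's `conv_inv_sq_le` row (`a = 2`). [folklore] -/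
theorem abs_green2_thirdDiff_EK_le : ∃ c : ℝ, 0 ≤ c ∧ ∀ (P : Params) (_ : P.d = 3) (k : ℕ) (hk : k ≤ P.m + P.K)
    (G : TorusSite P.d (P.L ^ k * P.sitesPerDir k) → ℝ),
    (∀ t : TorusSite P.d (P.L ^ k * P.sitesPerDir k),
      G t = (∑ q ∈ (univ : Finset (TorusSite P.d (P.L ^ k * P.sitesPerDir k))).erase 0,
        Real.cos (∑ i, latticeMomentum (P.L ^ k * P.sitesPerDir k) q i * ((t i).val : ℝ))
          / dispersion (latticeMomentum (P.L ^ k * P.sitesPerDir k) q) ^ 2)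
        / (((P.L ^ k * P.sitesPerDir k : ℕ) : ℝ)) ^ P.d) →
    ∀ (x z : Site P 0) (i j k' : Fin P.d),
      |(G ((EK hk z - EK hk x) + Pi.single i 1) - G ((EK hk z - EK hk x) + Pi.single i 1 - Pi.single j 1)
          - G (EK hk z - EK hk x) + G ((EK hk z - EK hk x) - Pi.single j 1))
        - (G ((EK hk z - EK hk x) - Pi.single k' 1 + Pi.single i 1) - G ((EK hk z - EK hk x) - Pi.single k' 1 + Pi.single i 1 - Pi.single j 1)
          - G ((EK hk z - EK hk x) - Pi.single k' 1) + G ((EK hk z - EK hk x) - Pi.single k' 1 - Pi.single j 1))|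
        ≤ c / (max 1 ((Site.tdist z x : ℕ) : ℝ)) ^ 2 := by
  obtain ⟨C, hC⟩ := green2_thirdDiff_mul_dist_sq_le_of_eq
  obtain ⟨C₀, hC₀, h₀⟩ := abs_green2_thirdDiff_le_of_eq
  refine ⟨max (3 * max C 0) C₀, le_max_of_le_right hC₀, ?_⟩
  intro P hd k hk G hG x z i j k'
  haveI : NeZero (P.L ^ k * P.sitesPerDir k) := ⟨mul_ne_zero (pow_ne_zero _ P.L_pos.ne') (P.sitesPerDir_ne_zero k)⟩
  refine abs_le_div_max_one_sq (h₀ hd _ G hG i j k' _) ?_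
  by_cases hzx : z = x
  · subst hzx
    rw [tdist_self]; simp only [Nat.cast_zero]; rw [zero_pow two_ne_zero, mul_zero]; positivity
  · have ht : (EK hk z - EK hk x : TorusSite P.d (P.L ^ k * P.sitesPerDir k)) ≠ 0 := fun h =>
      hzx ((EK hk).injective (sub_eq_zero.1 h))
    have h1 := (hC hd (P.L ^ k * P.sitesPerDir k) G hG i j k' (EK hk z - EK hk x) ht).trans (le_max_left C 0)
    exact mul_tdist_sq_le_of_mul_sum_sq hd hk z x h1

/-- ★★ **(K-6) the SIZE of `G̃₂`, recentred (linear growth)**: `|G̃₂(EK z − EK x) − G̃₂(0)| ≤ c·(1 + tdist(z,x))` for ALL `z, x` — the bounded gradient (K-3) summed along a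
`tdist`-geodesic from `x` to `z` (✓p670497 `norm_sub_le_tdist_mul_grad` at `c = 1` applied to `y ↦ G̃₂(EK y − EK x)`; one step `y ↦ y.shift μ` moves the argument by `e_μ`, ✓ `EK_shift`).
The engine's `conv_lin_le` row (`a = −1`). [folklore] -/
theorem abs_green2_sub_zero_EK_le : ∃ c : ℝ, 0 ≤ c ∧ ∀ (P : Params) (_ : P.d = 3) (k : ℕ) (hk : k ≤ P.m + P.K)
    (G : TorusSite P.d (P.L ^ k * P.sitesPerDir k) → ℝ),
    (∀ t : TorusSite P.d (P.L ^ k * P.sitesPerDir k),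
      G t = (∑ q ∈ (univ : Finset (TorusSite P.d (P.L ^ k * P.sitesPerDir k))).erase 0,
        Real.cos (∑ i, latticeMomentum (P.L ^ k * P.sitesPerDir k) q i * ((t i).val : ℝ))
          / dispersion (latticeMomentum (P.L ^ k * P.sitesPerDir k) q) ^ 2)
        / (((P.L ^ k * P.sitesPerDir k : ℕ) : ℝ)) ^ P.d) →
    ∀ (x z : Site P 0), |G (EK hk z - EK hk x) - G 0| ≤ c * (1 + ((Site.tdist z x : ℕ) : ℝ)) := by
  obtain ⟨C, hC, h⟩ := abs_green2_grad_EK_le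
  refine ⟨C, hC, ?_⟩
  intro P hd k hk G hG x z
  set f : SiteField P 0 ℝ := fun y => G (EK hk y - EK hk x) with hf
  have ha : ∀ b : PBond P 0, ‖grad (1 : ℝ) f b‖ ≤ C := by
    intro b
    rw [grad, one_smul, Real.norm_eq_abs, hf]
    simp only
    have e : EK hk b.tgt - EK hk x = (EK hk b.src - EK hk x) + Pi.single b.dir 1 := by
      rw [PBond.tgt, EK_shift]
      show EK hk b.src + Pi.single b.dir 1 - EK hk x = EK hk b.src - EK hk x + Pi.single b.dir 1
      abel
    rw [e]
    exact h P hd k hk G hG x b.src b.dir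
  have hpath := norm_sub_le_tdist_mul_grad (one_ne_zero) f ha x z
  rw [Real.norm_eq_abs, hf] at hpath
  simp only [sub_self, abs_one, inv_one, one_mul] at hpath
  rw [tdist_comm] at hpath
  calc |G (EK hk z - EK hk x) - G 0| ≤ ((Site.tdist z x : ℕ) : ℝ) * C := hpath
    _ ≤ C * (1 + ((Site.tdist z x : ℕ) : ℝ)) := by nlinarith [Nat.cast_nonneg (α := ℝ) (Site.tdist z x)]

end Summit.QuantumFields.YangMills.Theorems.Prop7TorusGreenKernelRows
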